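import Mathlib
import HarnessLib
import HarnessLib.Audit
import Summits.MatrixMultiplication.Statement
import Literature.Computability.AlgebraicComplexity.MatrixMultiplicationExponent
import Literature.Computability.AlgebraicComplexity.AsymptoticSpectrum
import Literature.Computability.AlgebraicComplexity.SchoenhageTau
import Literature.Barriers.MatrixMultiplication.UniversalMethodBarrier
import Literature.Computability.AlgebraicComplexity.FlatteningBound
import HarnessLib.Audit.Status.Attr

/-!
Route: StrassenDefect

DORMANT since 2026-08-22T05:17:54Z (reconciler: no traction for 5.1 d (last activity item-evidence-added at 2026-08-17T02:26:07Z); parked, not closed — `ledger route dormant route-MatrixMultiplication-StrassenDefect --off` to reactivate) — unstaffed, not closed; items shared with open routes are served there. `ledger route dormant <id> --off` reactivates.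

# Route StrassenDefect — vanishing Strassen defect — ⟨mN⟩ from m² blocks ⟨N⟩ plus asymptotically
negligible junk

It suffices to show X = VANISHING (RELATIVE) STRASSEN DEFECT: for every ε > 0 there are a scale
ratio m ≥ 2, a block size
N ≥ 1 and a junk tensor J (any finite format) such that the big matrix product ⟨mN,mN,mN⟩ is a
DEGENERATION (Alman §2.4 /
BCS ⊴, `PolyDegeneratesTo`) of (m² ⊙ ⟨N,N,N⟩) ⊕ J — m² independent block products of 1/m the size,
plus junk — with junk of
asymptotic rank R~(J) ≤ ε·m²N², i.e. price per block → 0. Block recursion (Strassen ⊗ id_N) is the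
case J = (R(⟨m⟩) − m²) ⊙ ⟨N⟩,
price ≥ 1 − 1/m per block; X asks for self-reductions that mix the inner (N×N) and outer (m×m)
structure. One line of Strassen
calculus (support DefectInequality: (mN)^ω ≤ m²N^ω + R~(J)) turns X into m^ω ≤ (1+ε)m² for every ε,
hence ω(ℂ) = 2.
Realises card strassen-defect-cocycle-price (d_m(N) := min R~(J) = "price of the Pauli/Weyl
2-cocycle of Z_m² over the coefficient
algebra M_N"; it absorbed two-scale-self-reduction, whose constant ρ̲(N) ≤ 6 is crux SixBlocks).
Lean: `∀ ε : ℝ, 0 < ε → ∃ m N a b c : ℕ, 2 ≤ m ∧ 1 ≤ N ∧ ∃ J : Fin a → Fin b → Fin c → ℂ,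
Literature.Barriers.MatrixMultiplication.PolyDegeneratesTo
(Literature.Computability.AlgebraicComplexity.directSumTensor
(Literature.Computability.AlgebraicComplexity.kroneckerTensor
(Literature.Computability.AlgebraicComplexity.unitTensor ℂ (m ^ 2))
(Literature.Computability.AlgebraicComplexity.matMulTensor ℂ N N N)) J)
(Literature.Computability.AlgebraicComplexity.matMulTensor ℂ (m * N) (m * N) (m * N)) ∧
Literature.Computability.AlgebraicComplexity.asymptoticRank J ≤ ε * ((m : ℝ) ^ 2 * (N : ℝ) ^ 2)`

## Assembly
Given X, fix ε > 0 and the instance (m, N, J). DefectInequality gives (mN)^ω ≤ m²N^ω + R~(J) ≤ m²N^ω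
+ ε m²N²; since ω ≥ 2
(omega_two_le, FlatteningBound) N² ≤ N^ω, so m^ω ≤ (1+ε)m² and ω ≤ 2 + log_m(1+ε) ≤ 2 + log₂(1+ε).
Letting ε → 0 gives ω ≤ 2,
and with ω ≥ 2, ω(ℂ) = 2 = MatrixMultiplication. Ingredients all PROVED in the cone except
AsymptoticRankSubadditive (support,
provable now from the proved duality). The cruxes are milestones of X (SixBlocks: first non-block
self-reduction; LinearDefect:
first one beating block recursion in the N²-accounting) and an alternative architecture with its own
assembly (HalfSizeBlockCover).

Rationale: WHY THIS LINE. Every route to ω = 2 through a FIXED intermediate tensor is barred (InfimumNotMinimum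
for basic algorithms, Irreversibility /
UniversalMethod / Rectangular for CW-type powers); here the source m²⊙⟨N⟩ ⊕ J varies with N and is
matrix multiplication itself, so
those barrier values are vacuous, and the only proved obstruction is the GIT floor J ≠ 0 (⟨mN⟩ and
m²⊙⟨N⟩ are non-isomorphic
POLYSTABLE tensors of one format, BurgisserIkenmeyer2017 Prop 4.8/Cor 4.9 + Kempf–Ness: a closed
orbit is never a proper
same-format degeneration of another). Algebraically ⟨mN⟩ is the multiplication tensor of the twisted
group algebra ℂ^σ[Z_m²] ⊗ M_N
(Weyl–Pauli cocycle σ) and m²⊙⟨N⟩ that of ℂ[Z_m²] ⊗ M_N: J is the price of untwisting the cocycle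
over matrix coefficients — 3 per
unit over ℂ (7 = 4 + 3: Strassen1969, HopcroftKerr1971, Winograd1971, DeGroote1978), conjecturally
o(1) over M_N, where zero divisors
of End(M_N) can kill cross terms scalars cannot (matrix-valued Brent equations). Imported: GIT of
tensor orbits (polystability,
Kempf–Ness) for the floor and for the negative side; projective representations / twisted group
algebras for the construction;
Strassen's spectral theory (duality PROVED in tree: strassen_duality_asymptoticRank_holds) for the
bookkeeping; Romani1982's
generalized ASI and KauersMoosbauerWood2026 ("divide less, conquer more": ⟨6,6,6⟩ ≤ 137⊙⟨1⟩ ⊕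
8⊙⟨1,1,2⟩) and AlmanLi2026 §7.3/§8
(sum-to-sum identities, optimal-bound formalism) are the nearest calculus; none asks for
self-reductions into EQUAL blocks with
o(1) junk. Versus open routes: no fixed small tensor (AsymptoticRankCW), no spectrum classification
(AsymptoticSpectrum), drops the
group of GroupTheoreticSTPP (TPP embeddings ⟨n⟩ ≤ ℂ[G] ≅ ⊕⟨d_i⟩ are instances of crux
HalfSizeBlockCover); CatalyticDegeneration's
SeventhOnCredit (⟨6⟩ ⊕ C ⊵ ⟨2,2,2⟩ ⊕ C, bystander RETURNED) and our SixBlocks (6⊙⟨N⟩ ⊵ ⟨2N⟩,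
matrix-coefficient blocks CONSUMED) are
different "six instead of seven" statements — neither implies the other; SchurWeylEquivariant
decomposes Kronecker powers ⟨2⟩^{⊗k}
equivariantly, with no second scale N. Negatives index empty.

RANKED CRUXES. #0 VanishingStrassenDefect (target) — X as in § Thesis: ∀ε>0 ∃m≥2 ∃N≥1 ∃J,
(m²⊙⟨N,N,N⟩) ⊕ J ⊵ ⟨mN,mN,mN⟩ and R~(J) ≤ ε·m²·N². Its negation is the UNIFORM COCYCLE-PRICE FLOOR
(∃c>0 ∀m,N,J: degeneration ⇒ R~(J) ≥ c·m²N²), which follows from ω > 2 (c = 2^(ω−2) − 1 by duality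
and Q~(⟨N⟩) = N²) but not conversely — refuters attack X through it. (why it might fail: A priori
stronger than ω=2: block recursion pays ≥ (1−1/m) per block at every scale and a CW82-type
strictness could make the per-block price bounded below uniformly (uniform cocycle-price floor),
killing X while ω=2 stays open.) [BurgisserIkenmeyer2017, CoppersmithWinograd1982, AlmanLi2026,
Strassen1988, HopcroftKerr1971]
#2 SixBlocks (crux) — the two-scale constant drops below Strassen at some scale: ∃N≥1 with 6⊙⟨N,N,N⟩
⊵ ⟨2N,2N,2N⟩ (degeneration; 7⊙⟨N⟩ ≥ ⟨2N⟩ is Strassen⊗id_N, 4⊙⟨N⟩ ⋭ ⟨2N⟩ is the GIT floor, 5 or 6 is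
the first bit of information). Junk = 2⊙⟨N⟩: "the cocycle costs ≤ 2 blocks over M_N". The ASYMPTOTIC
version ⟨2N⟩ ≲ 6⊙⟨N⟩ is TRUE for every N (2^ω < 6 + Strassen's spectral theorem, both in tree), so
the crux is exactness at one finite scale. NEGATION welcome: ∀N, 6⊙⟨N⟩ ⋭ ⟨2N⟩ ("seven is rigid at
every scale ratio 2") is a new kind of lower bound — orbit-closure non-membership between two
explicit polystable-by-blocks tensors — and closes this item as refuted (card
two-scale-self-reduction C1/C3). [difficulty: L] (why it might fail: Seven may be rigid at every
scale: M_N-equivariant (block) schemes need 7 (HopcroftKerr1971, Winograd1971; DeGroote1978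
uniqueness), and any instance is a border-rank record in disguise (N=2 forces bR(⟨4,4,4⟩) ≤ 42,
window [29,48]; N=3 forces bR(⟨6,6,6⟩) ≤ 120).) [HopcroftKerr1971, Winograd1971, DeGroote1978,
LandsbergMichalek2018, KauersMoosbauerWood2026, arXiv:2606.13408]
#3 LinearDefect (crux) — somewhere a self-reduction beats block recursion by one order in m: ∃m≥2
∃N≥1 ∃J, (m²⊙⟨N⟩) ⊕ J ⊵ ⟨mN⟩ with R~(J) < m·N² (block recursion has junk (bR(⟨m⟩) − m²)⊙⟨N⟩, worth ≥
(m²−m)·N² ≥ m·N²). By DefectInequality m^ω < m² + m: m=2 gives only ω < log₂6, but m=3 gives ω <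
log₃12 = 2.262, m=4 gives ω < log₄20 = 2.161 — any instance with m ≥ 3 is a new world record
(2.3713). N=1 is excluded for every m by bR(⟨m⟩) ≥ 2m²−m (LandsbergMichalek2018) since R~(J) < m
forces J into an (m−1)³ format. [deps: SixBlocks] [difficulty: XL] (why it might fail: Would beat
ω<2.3713 by one finite identity for m≥3; needs junk that is border-expensive yet asymptotically
cheap (R~(J) < mN² with bR(J) ≥ bR(⟨mN⟩) − m²bR(⟨N⟩)), and no mechanism beyond matrix-coefficient
Brent equations is in hand; small (m,N) are record territory.) [LandsbergMichalek2018,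
AlmanDuanVassilevskaWilliamsXuXuZhou2025, Romani1982, KauersMoosbauerWood2026, AlmanLi2026]
#4 HalfSizeBlockCover (crux) — the all-matrix-junk architecture (group-free Wedderburn shape): ∀ε>0
∃n ∃ blocks d_1..d_p with 1 ≤ d_i ≤ n/2 such that ⊕_i ⟨d_i,d_i,d_i⟩ ⊵ ⟨n,n,n⟩ and Σ d_i² ≤ (1+ε)n²
(flattening forces Σd_i² ≥ n², polystability forces > n²). Romani's calculus gives n^ω ≤ Σ d_i^ω ≤
(n/2)^(ω−2)(1+ε)n², i.e. 2^(ω−2) ≤ 1+ε, so this crux implies ω = 2 ON ITS OWN (support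
HalfSizeCoverAssembly). Every TPP triple of size n in a group G with |G| ≤ (1+ε)n² and character
degrees ≤ n/2 is an instance (CohnUmans2003 embedding + Wedderburn, as a restriction); the crux
drops the group and allows degenerations. [difficulty: open-problem] (why it might fail: Needs
near-lossless covers Σd_i² ≤ (1+ε)n²: for group instances this is TPP at the square-root threshold
|S|=|T|=|U| ≈ |G|^(1/2), beyond every known construction; a CW82/Schönhage-type acceleration
argument may force Σd_i² ≥ (1+c)n² for all covers by half-size blocks.) [Romani1982, CohnUmans2003,
CohnKleinbergSzegedyUmans2005, KauersMoosbauerWood2026, CoppersmithWinograd1982,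
BlasiakCohnGrochowPrattUmans2023]
#9 AsymptoticRankSubadditive (support) — R~(s ⊕ t) ≤ R~(s) + R~(t) for 3-tensors over ℂ with finite
index types (provable now: Strassen duality strassen_duality_asymptoticRank_holds gives F with
F(s⊕t) = R~(s⊕t); additivity of universal spectral points and F ≤ R~; or directly from
kroneckerPow_directSumTensor_eq_sum_blockTensor). [difficulty: provable-now] [Strassen1988,
ChristandlVranaZuiddam2023, Zuiddam2018]
#9 DefectInequality (support) — the one line of Strassen calculus: if (m²⊙⟨N⟩) ⊕ J ⊵ ⟨mN⟩ (m,N ≥ 1)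
then (mN)^ω ≤ m²·N^ω + R~(J). Proof from the cone: R~ monotone under degeneration
(asymptoticRank_le_of_polyDegeneratesTo), subadditive (AsymptoticRankSubadditive), R~(t⊙⟨q,q,q⟩) =
t·q^ω (asymptoticRank_multiple_matMulTensor_cube), R~(⟨q,q,q⟩) = q^ω (asymptoticRank_matMulTensor).
[difficulty: provable-now] [Strassen1988, AlmanDuanVassilevskaWilliamsXuXuZhou2025, AlmanLi2026]
#9 HalfSizeCoverAssembly (support) — HalfSizeBlockCover → ω(ℂ) = 2 (Romani's generalized asymptotic
sum inequality in the degeneration/asymptotic-rank form: n^ω = R~(⟨n⟩) ≤ Σ R~(⟨d_i⟩) = Σ d_i^ω ≤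
(n/2)^(ω−2)·(1+ε)n², so 2^(ω−2) ≤ 1+ε for all ε; with ω ≥ 2 = omega_two_le). Needs subadditivity of
R~ over the Σ-indexed family matMulDirectSum (reindex to iterated directSumTensor). [difficulty: M]
[Romani1982, CohnUmans2003, Blaser2013]
#9 JunkNecessary (support) — the GIT floor d_m(N) ≥ 1: for m ≥ 2, N ≥ 1 the junk-free self-reduction
m²⊙⟨N⟩ ⊵ ⟨mN⟩ is impossible. Proof sketch: both tensors have format m²N² in each factor and are
POLYSTABLE (BurgisserIkenmeyer2017 Prop 4.8: support with uniform marginals + a stabilising torus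
with diagonal centraliser; Cor 4.9 for ⟨n,n,n⟩, ⟨r⟩, and the same proof for ⟨r⟩⊠⟨N,N,N⟩); for T with
closed SL³-orbit, closure(GL³·T) ⊆ ℂ*·SL³·T ∪ Nullcone, and ⟨mN⟩ ∉ Nullcone, so a degeneration would
be an isomorphism — but ⟨mN,mN,mN⟩ is indecomposable while m²⊙⟨N⟩ is not (or compare stabiliser
dimensions, BI17 §5). Needs Hilbert–Mumford/Kempf–Ness-level GIT absent from Mathlib (file as named
Literature facts and prove the tensor-specific part), or an elementary invariant. [difficulty: L]
[BurgisserIkenmeyer2017, Landsberg2017, BurgisserClausenShokrollahi1997]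

TWO-LAYER PLAN. Foreseen glued splits (none filed now). SixBlocks ⇐ MatrixBrent → LiftToDegeneration
→ SixBlocks, where MatrixBrent = "the Brent
equations of ⟨2,2,2⟩ with coefficients in E = End(M_N) = M_N ⊗ M_N^op have a 6-term (ε-)solution for
some N" (scalar = GL_N³-equivariant
solutions need 7 by HopcroftKerr1971/DeGroote1978; a 6-term solution must use zero divisors of E).
LinearDefect ⇐ (m=3 or 4 instance
with unit-tensor junk ⟨k⟩, k < mN², found by ε-ALS / Gröbner on the E-valued system) → LinearDefect.
X ⇐ PriceDecay (∀m ∃N,J: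
R~(J) ≤ C·m·N², a LinearDefect FAMILY in m) → X (pure bookkeeping: C·m ≤ ε m² for m ≥ C/ε).
HalfSizeBlockCover ⇐ TPPSquareRoot (a
TPP family with |G| ≤ (1+ε)n², d_max ≤ n/2) → restriction instance → cover.

KILL CRITERIA. ¬VanishingStrassenDefect, i.e. a UNIFORM COCYCLE-PRICE FLOOR ∃c>0 ∀m,N,J
(degeneration ⇒ R~(J) ≥ c·m²N²), closes the route
`refuted:VanishingStrassenDefect` (it is implied by ω > 2, so route BorderRankLowerBound succeeding
moots us too). ¬SixBlocks (seven
rigid at every scale) kills the matrix-junk branch at m = 2: pivot to LinearDefect/X with non-matrix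
junk only if the rigidity proof
is specific to junk 2⊙⟨N⟩; if it bounds all junk (R~(J) ≥ 3N² whenever 4⊙⟨N⟩ ⊕ J ⊵ ⟨2N⟩) restate X
with m ≥ 3 or close. A theorem
Σd_i² ≥ (1+c)n² for half-size covers refutes HalfSizeBlockCover only (drop it; the spine survives).
ω = 2 proved elsewhere moots
the route; JunkNecessary failing (a junk-free self-reduction!) would prove bR(⟨n,n,n⟩) = O(n²)-type
statements and supersede everything.

NOT DECOMPOSED YET. The construction mechanism below SixBlocks/LinearDefect (E-valued Brent system,
symmetry-breaking patterns classified by stabilisers in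
GL_N³ × GL_2³, ε-lifts), the amplification bookkeeping PriceDecay → X, the family/TPP instances of
HalfSizeBlockCover, and the GIT
facts behind JunkNecessary (polystability of ⟨r⟩⊠⟨N⟩, closed-orbit separation) are layer-2 children
or `--supports` lemmas, filed
only after a crux moves. No numerics item is filed: every small-(m,N) certificate is a border-rank
record hunt (refuter's costing) and
belongs to kit jobs attached as evidence, not to the item list.

CHEAPEST FALSIFIER. (1) Lookup, partly done: do the structured-decomposition catalogues
(KauersMoosbauerWood2026 arXiv:2602.11041; arXiv:2606.13408
frontier-closure catalog; flip-graph schemes) already contain ⟨2N⟩ ≤ 6⊙⟨N⟩ or any ⟨mN⟩ ≤ m²⊙⟨N⟩ ⊕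
(junk of rank < mN²)? Read: no —
their right-hand sides are 137⊙⟨1⟩ ⊕ 8⊙⟨1,1,2⟩-type, far from tight; a hit would make SixBlocks
`known`. (2) Kit: ε-parametrised ALS
for ⟨4,4,4⟩ ∈ closure(GL³·(6⊙⟨2,2,2⟩)) (formats 16 ← 24) and for (4⊙⟨2,2,2⟩) ⊕ ⟨k⟩ ⊵ ⟨4,4,4⟩, k =
1..7; a robust numerical NO at
N = 2 together with a Koszul-flattening certificate bR(⟨4,4,4⟩) > 42 would push every finite witness
to N ≥ 3 and make the
rigidity reading of SixBlocks the live one. Not run here (planner; no kit in this unit).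

NUMBERS. bR(⟨2,2,2⟩) = R = 7 (Landsberg 2006; computer-free DolezalekMichalek2026); bR(⟨n,n,n⟩) ≥
2n² − log₂n − 1 (LandsbergMichalek2018), so
bR(⟨4,4,4⟩) ≥ 29; R(⟨4,4,4⟩) ≤ 48 over ℂ (AlphaEvolve 2025, arXiv:2606.13408 p2), R(⟨3,3,3⟩) ≤ 23,
bR(⟨3,3,3⟩) ≤ 20 (Smirnov),
R(⟨6,6,6⟩) ≤ 153 (Moosbauer–Poole; KauersMoosbauerWood2026 §3). SixBlocks at N forces bR(⟨2N⟩) ≤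
6·bR(⟨N⟩): 42 at N=2, ≤ 120 at
N=3. LinearDefect record thresholds: m^ω < m²+m gives 2.585 (m=2), 2.262 (3), 2.161 (4), 2.113 (5)
vs ω < 2.371339
(AlmanDuanVassilevskaWilliamsXuXuZhou2025). Block-recursion price per block ≥ 1 − 1/m (bR(⟨m⟩) ≥ 2m²
− m). Known universal spectral
points (quantum functionals) all give F(⟨n,n,n⟩) = n², hence no spectral obstruction to any crux.
Items at open: 9 (1 target,
3 cruxes, 1 assembly, 4 support).

DEFINITION REQUESTS. None for the statements (PolyDegeneratesTo, directSumTensor, kroneckerTensor,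
unitTensor, matMulTensor, matMulDirectSum,
asymptoticRank, omega all exist). Wanted as named Literature facts for JunkNecessary (to be filed as
cite items by whoever takes it):
BurgisserIkenmeyer2017 Prop 4.8/Cor 4.9 (polystability criterion; ⟨r⟩, ⟨n,n,n⟩ polystable) and the
closed-orbit separation
consequence of Kempf–Ness/Luna (closure(GL³·T) ⊆ ℂ*·SL³·T ∪ Nullcone for polystable T).

Novelty: Searches (2026-08-15): `lit search` local/hybrid (searchd connection reset ×2), `--source zbmath
"matrix multiplication tensor direct
sum degeneration"` (1 hit: CVZ 2018), `--source s2 "fundamental invariants of orbit closures unit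
tensor matrix multiplication
polystable"` (2: arXiv:1511.02927), s2/arxiv/openalex otherwise rate-limited (429); `lit galaxy
search "twisted group algebra" --star
pdf` (15 hits, none on matrix multiplication), `"matrix multiplication tensor is polystable" --star
all` (0); `lit frontier
MatrixMultiplication --since 2022` (30 rows; relevant: arXiv:2605.21738, arXiv:2602.11041,
arXiv:2606.13408, doi:10.1090/bull/1880);
`lit read` arXiv:1511.02927 pp16–17 (Prop 4.8, Cor 4.9), arXiv:2605.21738 §5, §7.3, App. 8,
arXiv:2602.11041 §1–3 (Romani Thm 6,
⟨6,6,6⟩ ≤ 137⊙⟨1⟩ ⊕ 8⊙⟨1,1,2⟩), arXiv:2606.13408 (rank tables).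
Nearest prior art found: Romani1982 (doi:10.1137/0211020; generalized ASI for ⊕MaMu ≤ ⊕MaMu) and
KauersMoosbauerWood2026
(arXiv:2602.11041: decompose ⟨n⟩ into smaller MATRIX PRODUCTS, exponent 2.8019 from ⟨6,6,6⟩);
AlmanLi2026 (arXiv:2605.21738 §7.3/§8:
new sum-to-sum MaMu identities and the optimal-bound/relativization formalism); CohnUmans2003 (⟨n⟩ ≤
ℂ[G] ≅ ⊕⟨d_i⟩); BurgisserIkenmeyer2017
(arXiv:1511.02927 Cor 4.9, polystability); HopcroftKerr1971/Winograd1971/DeGroote1978 (7 is optimal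
and unique for block schemes).
Delta: fixes the shape to a SELF-REDUCTION ⟨mN⟩ ⊴ m²⊙⟨N⟩ ⊕ J into equal blocks, measures the junk by
asymptotic rank per block
(th  [refs: 10.1090/bull/1880, 10.1137/0211020, 1511.02927, 2605.21738, 2602.11041, 2606.13408, doi:10.1090/bull/1880, doi:10.1137/0211020, Romani1982, KauersMoosbauerWood2026, AlmanLi2026, CohnUmans2003, BurgisserIkenmeyer2017, HopcroftKerr1971, Winograd1971, DeGroote1978]

Barriers (technique_class: self-reduction-into-MaMu-blocks, GIT-polystability): - technique_class: self-reduction-into-MaMu-blocks, GIT-polystability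
- Literature.Barriers.MatrixMultiplication.InfimumNotMinimumBarrier: its theorem is strictness for
MaMu-sums INSIDE A UNIT TENSOR (basic algorithms, Σ(kmn)^(ω/3) < bR); here MaMu sits inside a SUM OF
MaMu blocks plus junk and the certificate is a family/limit (price → 0), not one algorithm — outside
its class; honestly, the bet is that CW82-strictness does not upgrade to a uniform per-block price
floor (that upgrade = ¬X is our kill criterion).
- Literature.Barriers.MatrixMultiplication.IrreversibilityBarrier: bounds ω-certificates from powers
of a FIXED tensor by its irreversibility; our source m²⊙⟨N⟩ ⊕ J changes with N and contains matrix
multiplication itself (irreversibility → 1 along ⟨N⟩), so the bound is vacuous — evaded by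
construction.
- Literature.Barriers.MatrixMultiplication.UniversalMethodBarrier: same class (universal method on a
fixed T such as CW_q); no fixed starting tensor here; vacuous.
- Literature.Barriers.MatrixMultiplication.RectangularBarrier: concerns α/rectangular certificates
from CW-type tensors; not this technique class.
- Literature.Barriers.MatrixMultiplication.UnstableTensorBarrier: kills powers of UNSTABLE tensors
of bounded size; ⟨mN⟩, ⟨N⟩, ⟨r⟩ and their Kronecker products are polystable (BI17 Cor 4.9) and the
sizes are unbounded — outside its class (its evasion (i) and (iv) are exactly our setting).
- Literature.Barriers.MatrixMultiplication.LinearRankMethodBarrier: bites o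

History (route lifecycle, newest last):
- 2026-08-15T16:19:33Z · rev 2: restated Assembly (stmt-MatrixMultiplication-4080) — route-repair follow-up: align the Assembly item with the certified deciding theorem closes : VanishingStrassenDefect → DefectInequality → MatrixMultiplication ( (planner-rbadge-MatrixMultiplication-StrassenDe-f9bcecb5-g2-0)
- 2026-08-16T04:11:22Z · AUTO-CRUX (backfill): VanishingStrassenDefect — hypotheses of the deciding theorem that nothing in the route derives are cruxes (operator:999:1085951)
- 2026-08-22T05:17:54Z · DORMANT — reconciler: no traction for 5.1 d (last activity item-evidence-added at 2026-08-17T02:26:07Z); parked, not closed — `ledger route dormant route-MatrixMultiplica (operator:999:1579801)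

sub-problem: MatrixMultiplication · status: dormant · opened planner-plancard-MatrixMultiplication-MatrixM-d5c7597e-0 2026-08-15T11:27:31Z · rev 2 · ledger route-MatrixMultiplication-StrassenDefect
GENERATED by the gate from the ledger (D-0016/17). Provers cite these decls: `theorem foo : Summit.MatrixMultiplication.MatrixMultiplication.Theses.StrassenDefect.<Decl> := …` in Summits/MatrixMultiplication/MatrixMultiplication/Theorems/<Name>.lean.
-/

namespace Summit.MatrixMultiplication.MatrixMultiplication.Theses.StrassenDefect

open scoped BigOperators Topology Manifold Classical MeasureTheory ProbabilityTheory Matrix InnerProductSpace ComplexConjugate ContinuousMap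
open Filter Set Function TopologicalSpace MeasureTheory

attribute [summit_statement] _root_.MatrixMultiplication

/-- item stmt-MatrixMultiplication-4072 · crux (kind.auto-crux: conjecture-grade) · rank 0 · open · by planner
why it might fail: A priori stronger than ω=2: block recursion pays ≥ (1−1/m) per block at every scale and a CW82-type strictness could make the per-block price bounded below uniformly (uniform cocycle-price floor), killing X while ω=2 stays open.
sources: BurgisserIkenmeyer2017, CoppersmithWinograd1982, AlmanLi2026, Strassen1988, HopcroftKerr1971
[target] X as in § Thesis: ∀ε>0 ∃m≥2 ∃N≥1 ∃J, (m²⊙⟨N,N,N⟩) ⊕ J ⊵ ⟨mN,mN,mN⟩ and R~(J) ≤ ε·m²·N². Its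
negation is the UNIFORM COCYCLE-PRICE FLOOR (∃c>0 ∀m,N,J: degeneration ⇒ R~(J) ≥ c·m²N²), which
follows from ω > 2 (c = 2^(ω−2) − 1 by duality and Q~(⟨N⟩) = N²) but not conversely — refuters
attack X through it. -/
@[route_item "route-MatrixMultiplication-StrassenDefect", crux]
def VanishingStrassenDefect : Prop :=
  ∀ ε : ℝ, 0 < ε → ∃ m N a b c : ℕ, 2 ≤ m ∧ 1 ≤ N ∧ ∃ J : Fin a → Fin b → Fin c → ℂ, Literature.Barriers.MatrixMultiplication.PolyDegeneratesTo (Literature.Computability.AlgebraicComplexity.directSumTensor (Literature.Computability.AlgebraicComplexity.kroneckerTensor (Literature.Computability.AlgebraicComplexity.unitTensor ℂ (m ^ 2)) (Literature.Computability.AlgebraicComplexity.matMulTensor ℂ N N N)) J) (Literature.Computability.AlgebraicComplexity.matMulTensor ℂ (m * N) (m * N) (m * N)) ∧ Literature.Computability.AlgebraicComplexity.asymptoticRank J ≤ ε * ((m : ℝ) ^ 2 * (N : ℝ) ^ 2)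

/-- item stmt-MatrixMultiplication-4073 · crux · rank 2 · open · by planner
why it might fail: Seven may be rigid at every scale: M_N-equivariant (block) schemes need 7 (HopcroftKerr1971, Winograd1971; DeGroote1978 uniqueness), and any instance is a border-rank record in disguise (N=2 forces bR(⟨4,4,4⟩) ≤ 42, window [29,48]; N=3 forces bR(⟨6,6,6⟩) ≤ 120).
sources: HopcroftKerr1971, Winograd1971, DeGroote1978, LandsbergMichalek2018, KauersMoosbauerWood2026, arXiv:2606.13408
[crux] the two-scale constant drops below Strassen at some scale: ∃N≥1 with 6⊙⟨N,N,N⟩ ⊵ ⟨2N,2N,2N⟩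
(degeneration; 7⊙⟨N⟩ ≥ ⟨2N⟩ is Strassen⊗id_N, 4⊙⟨N⟩ ⋭ ⟨2N⟩ is the GIT floor, 5 or 6 is the first bit
of information). Junk = 2⊙⟨N⟩: "the cocycle costs ≤ 2 blocks over M_N". The ASYMPTOTIC version ⟨2N⟩
≲ 6⊙⟨N⟩ is TRUE for every N (2^ω < 6 + Strassen's spectral theorem, both in tree), so the crux is
exactness at one finite scale. NEGATION welcome: ∀N, 6⊙⟨N⟩ ⋭ ⟨2N⟩ ("seven is rigid at every scale
ratio 2") is a new kind of lower bound — orbit-closure non-membership between two explicit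
polystable-by-blocks tensors — and closes this item as refuted (card two-scale-self-reduction
C1/C3). [difficulty: L] -/
@[route_item "route-MatrixMultiplication-StrassenDefect"]
def SixBlocks : Prop :=
  ∃ N : ℕ, 1 ≤ N ∧ Literature.Barriers.MatrixMultiplication.PolyDegeneratesTo (Literature.Computability.AlgebraicComplexity.kroneckerTensor (Literature.Computability.AlgebraicComplexity.unitTensor ℂ 6) (Literature.Computability.AlgebraicComplexity.matMulTensor ℂ N N N)) (Literature.Computability.AlgebraicComplexity.matMulTensor ℂ (2 * N) (2 * N) (2 * N))

/-- item stmt-MatrixMultiplication-4074 · crux · rank 3 · open · by planner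
why it might fail: Would beat ω<2.3713 by one finite identity for m≥3; needs junk that is border-expensive yet asymptotically cheap (R~(J) < mN² with bR(J) ≥ bR(⟨mN⟩) − m²bR(⟨N⟩)), and no mechanism beyond matrix-coefficient Brent equations is in hand; small (m,N) are record territory.
sources: LandsbergMichalek2018, AlmanDuanVassilevskaWilliamsXuXuZhou2025, Romani1982, KauersMoosbauerWood2026, AlmanLi2026
[crux] somewhere a self-reduction beats block recursion by one order in m: ∃m≥2 ∃N≥1 ∃J, (m²⊙⟨N⟩) ⊕
J ⊵ ⟨mN⟩ with R~(J) < m·N² (block recursion has junk (bR(⟨m⟩) − m²)⊙⟨N⟩, worth ≥ (m²−m)·N² ≥ m·N²).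
By DefectInequality m^ω < m² + m: m=2 gives only ω < log₂6, but m=3 gives ω < log₃12 = 2.262, m=4
gives ω < log₄20 = 2.161 — any instance with m ≥ 3 is a new world record (2.3713). N=1 is excluded
for every m by bR(⟨m⟩) ≥ 2m²−m (LandsbergMichalek2018) since R~(J) < m forces J into an (m−1)³
format. [deps: SixBlocks] [difficulty: XL] -/
@[route_item "route-MatrixMultiplication-StrassenDefect"]
def LinearDefect : Prop :=
  ∃ m N a b c : ℕ, 2 ≤ m ∧ 1 ≤ N ∧ ∃ J : Fin a → Fin b → Fin c → ℂ, Literature.Barriers.MatrixMultiplication.PolyDegeneratesTo (Literature.Computability.AlgebraicComplexity.directSumTensor (Literature.Computability.AlgebraicComplexity.kroneckerTensor (Literature.Computability.AlgebraicComplexity.unitTensor ℂ (m ^ 2)) (Literature.Computability.AlgebraicComplexity.matMulTensor ℂ N N N)) J) (Literature.Computability.AlgebraicComplexity.matMulTensor ℂ (m * N) (m * N) (m * N)) ∧ Literature.Computability.AlgebraicComplexity.asymptoticRank J < (m : ℝ) * (N : ℝ) ^ 2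

/-- item stmt-MatrixMultiplication-4075 · crux · rank 4 · open · by planner
why it might fail: Needs near-lossless covers Σd_i² ≤ (1+ε)n²: for group instances this is TPP at the square-root threshold |S|=|T|=|U| ≈ |G|^(1/2), beyond every known construction; a CW82/Schönhage-type acceleration argument may force Σd_i² ≥ (1+c)n² for all covers by half-size blocks.
sources: Romani1982, CohnUmans2003, CohnKleinbergSzegedyUmans2005, KauersMoosbauerWood2026, CoppersmithWinograd1982, BlasiakCohnGrochowPrattUmans2023
[crux] the all-matrix-junk architecture (group-free Wedderburn shape): ∀ε>0 ∃n ∃ blocks d_1..d_p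
with 1 ≤ d_i ≤ n/2 such that ⊕_i ⟨d_i,d_i,d_i⟩ ⊵ ⟨n,n,n⟩ and Σ d_i² ≤ (1+ε)n² (flattening forces
Σd_i² ≥ n², polystability forces > n²). Romani's calculus gives n^ω ≤ Σ d_i^ω ≤ (n/2)^(ω−2)(1+ε)n²,
i.e. 2^(ω−2) ≤ 1+ε, so this crux implies ω = 2 ON ITS OWN (support HalfSizeCoverAssembly). Every TPP
triple of size n in a group G with |G| ≤ (1+ε)n² and character degrees ≤ n/2 is an instance
(CohnUmans2003 embedding + Wedderburn, as a restriction); the crux drops the group and allows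
degenerations. [difficulty: open-problem] -/
@[route_item "route-MatrixMultiplication-StrassenDefect"]
def HalfSizeBlockCover : Prop :=
  ∀ ε : ℝ, 0 < ε → ∃ (n p : ℕ) (d : Fin p → ℕ), 1 ≤ n ∧ (∀ i, 1 ≤ d i ∧ 2 * d i ≤ n) ∧ Literature.Barriers.MatrixMultiplication.PolyDegeneratesTo (Literature.Computability.AlgebraicComplexity.matMulDirectSum ℂ d d d) (Literature.Computability.AlgebraicComplexity.matMulTensor ℂ n n n) ∧ (∑ i, ((d i : ℕ) : ℝ) ^ 2) ≤ (1 + ε) * (n : ℝ) ^ 2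

/-- item stmt-MatrixMultiplication-4076 · support · rank 9 · closed · proved by Summit.MatrixMultiplication.MatrixMultiplication.Theorems.asymptoticRankSubadditive_proof @ 4fa1f66ab806 (prover) · by planner
sources: Strassen1988, ChristandlVranaZuiddam2023, Zuiddam2018
[support] R~(s ⊕ t) ≤ R~(s) + R~(t) for 3-tensors over ℂ with finite index types (provable now:
Strassen duality strassen_duality_asymptoticRank_holds gives F with F(s⊕t) = R~(s⊕t); additivity of
universal spectral points and F ≤ R~; or directly from
kroneckerPow_directSumTensor_eq_sum_blockTensor). [difficulty: provable-now] -/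
@[route_item "route-MatrixMultiplication-StrassenDefect"]
def AsymptoticRankSubadditive : Prop :=
  ∀ (ι κ μ ι' κ' μ' : Type) [Fintype ι] [Fintype κ] [Fintype μ] [Fintype ι'] [Fintype κ'] [Fintype μ'] (s : ι → κ → μ → ℂ) (t : ι' → κ' → μ' → ℂ), Literature.Computability.AlgebraicComplexity.asymptoticRank (Literature.Computability.AlgebraicComplexity.directSumTensor s t) ≤ Literature.Computability.AlgebraicComplexity.asymptoticRank s + Literature.Computability.AlgebraicComplexity.asymptoticRank t

/-- item stmt-MatrixMultiplication-4077 · support · rank 9 · closed · proved by Summit.MatrixMultiplication.MatrixMultiplication.Theorems.DefectInequality_proof @ 81af629f16d2 (prover) · by planner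
sources: Strassen1988, AlmanDuanVassilevskaWilliamsXuXuZhou2025, AlmanLi2026
[support] the one line of Strassen calculus: if (m²⊙⟨N⟩) ⊕ J ⊵ ⟨mN⟩ (m,N ≥ 1) then (mN)^ω ≤ m²·N^ω +
R~(J). Proof from the cone: R~ monotone under degeneration (asymptoticRank_le_of_polyDegeneratesTo),
subadditive (AsymptoticRankSubadditive), R~(t⊙⟨q,q,q⟩) = t·q^ω
(asymptoticRank_multiple_matMulTensor_cube), R~(⟨q,q,q⟩) = q^ω (asymptoticRank_matMulTensor).
[difficulty: provable-now] -/
@[route_item "route-MatrixMultiplication-StrassenDefect", crux]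
def DefectInequality : Prop :=
  ∀ m N a b c : ℕ, 1 ≤ m → 1 ≤ N → ∀ J : Fin a → Fin b → Fin c → ℂ, Literature.Barriers.MatrixMultiplication.PolyDegeneratesTo (Literature.Computability.AlgebraicComplexity.directSumTensor (Literature.Computability.AlgebraicComplexity.kroneckerTensor (Literature.Computability.AlgebraicComplexity.unitTensor ℂ (m ^ 2)) (Literature.Computability.AlgebraicComplexity.matMulTensor ℂ N N N)) J) (Literature.Computability.AlgebraicComplexity.matMulTensor ℂ (m * N) (m * N) (m * N)) → ((m : ℝ) * N) ^ (Literature.Computability.AlgebraicComplexity.omega ℂ) ≤ (m : ℝ) ^ 2 * (N : ℝ) ^ (Literature.Computability.AlgebraicComplexity.omega ℂ) + Literature.Computability.AlgebraicComplexity.asymptoticRank J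

/-- item stmt-MatrixMultiplication-4078 · support · rank 9 · closed · proved by Summit.MatrixMultiplication.MatrixMultiplication.Theorems.HalfSizeCoverAssembly_proof @ 2b49af526fb0 (prover) · by planner
sources: Romani1982, CohnUmans2003, Blaser2013
[support] HalfSizeBlockCover → ω(ℂ) = 2 (Romani's generalized asymptotic sum inequality in the
degeneration/asymptotic-rank form: n^ω = R~(⟨n⟩) ≤ Σ R~(⟨d_i⟩) = Σ d_i^ω ≤ (n/2)^(ω−2)·(1+ε)n², so
2^(ω−2) ≤ 1+ε for all ε; with ω ≥ 2 = omega_two_le). Needs subadditivity of R~ over the Σ-indexed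
family matMulDirectSum (reindex to iterated directSumTensor). [difficulty: M] -/
@[route_item "route-MatrixMultiplication-StrassenDefect"]
def HalfSizeCoverAssembly : Prop :=
  (∀ ε : ℝ, 0 < ε → ∃ (n p : ℕ) (d : Fin p → ℕ), 1 ≤ n ∧ (∀ i, 1 ≤ d i ∧ 2 * d i ≤ n) ∧ Literature.Barriers.MatrixMultiplication.PolyDegeneratesTo (Literature.Computability.AlgebraicComplexity.matMulDirectSum ℂ d d d) (Literature.Computability.AlgebraicComplexity.matMulTensor ℂ n n n) ∧ (∑ i, ((d i : ℕ) : ℝ) ^ 2) ≤ (1 + ε) * (n : ℝ) ^ 2) → MatrixMultiplication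

/-- item stmt-MatrixMultiplication-4079 · support · rank 9 · closed · proved by Summit.MatrixMultiplication.MatrixMultiplication.Theorems.junkNecessary_proof (prover) · by planner
sources: BurgisserIkenmeyer2017, Landsberg2017, BurgisserClausenShokrollahi1997
[support] the GIT floor d_m(N) ≥ 1: for m ≥ 2, N ≥ 1 the junk-free self-reduction m²⊙⟨N⟩ ⊵ ⟨mN⟩ is
impossible. Proof sketch: both tensors have format m²N² in each factor and are POLYSTABLE
(BurgisserIkenmeyer2017 Prop 4.8: support with uniform marginals + a stabilising torus with diagonal
centraliser; Cor 4.9 for ⟨n,n,n⟩, ⟨r⟩, and the same proof for ⟨r⟩⊠⟨N,N,N⟩); for T with closed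
SL³-orbit, closure(GL³·T) ⊆ ℂ*·SL³·T ∪ Nullcone, and ⟨mN⟩ ∉ Nullcone, so a degeneration would be an
isomorphism — but ⟨mN,mN,mN⟩ is indecomposable while m²⊙⟨N⟩ is not (or compare stabiliser
dimensions, BI17 §5). Needs Hilbert–Mumford/Kempf–Ness-level GIT absent from Mathlib (file as named
Literature facts and prove the tensor-specific part), or an elementary invariant. [difficulty: L] -/
@[route_item "route-MatrixMultiplication-StrassenDefect"]
def JunkNecessary : Prop :=
  ∀ m N : ℕ, 2 ≤ m → 1 ≤ N → ¬ Literature.Barriers.MatrixMultiplication.PolyDegeneratesTo (Literature.Computability.AlgebraicComplexity.kroneckerTensor (Literature.Computability.AlgebraicComplexity.unitTensor ℂ (m ^ 2)) (Literature.Computability.AlgebraicComplexity.matMulTensor ℂ N N N)) (Literature.Computability.AlgebraicComplexity.matMulTensor ℂ (m * N) (m * N) (m * N))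

-- earlier Assembly (stmt-MatrixMultiplication-4080, replaced 2026-08-15T16:19:33Z -> stmt-MatrixMultiplication-10621): retired by None — (∀ ε : ℝ, 0 < ε → ∃ m N a b c : ℕ, 2 ≤ m ∧ 1 ≤ N ∧ ∃ J : Fin a → Fin b → Fin c → ℂ, Literature.Barriers.MatrixMultiplication.PolyDegeneratesTo (Literature.Computability.AlgebraicComplexity.directSumTensor (Literature.Computability.AlgebraicComplexity.kroneckerTenso
/-- item stmt-MatrixMultiplication-10621 · assembly · rank 1 · closed · proved by Summit.MatrixMultiplication.MatrixMultiplication.Theorems.strassenDefect_assembly_proof @ 2b7c8b0311b0 (prover) · by planner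
sources: Strassen1988, Blaser2013, AlmanDuanVassilevskaWilliamsXuXuZhou2025
[assembly] VanishingStrassenDefect → DefectInequality → MatrixMultiplication (ω(ℂ) = 2): exactly the
type of the deciding theorem `closes` (proved in this file: ω ≥ 2 = omega_two_le; ω ≤ 2 + δ from X
at ε = δ·log 2 and DefectInequality, then logs). Supersedes the rev-0 Assembly that inlined X;
real-analysis bookkeeping only. -/
@[route_item "route-MatrixMultiplication-StrassenDefect"]
def Assembly : Prop :=
  VanishingStrassenDefect → DefectInequality → MatrixMultiplication

/-! D-0027 §2.1 — DECIDING THEOREM (planner-authored via `route open/edit --closes-file`; by planner-rbadge-MatrixMultiplication-StrassenDe-f9bcecb5-g2-0 2026-08-15T16:17:56Z):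
its hypotheses are this route's items and its conclusion the sub-problem Statement (glue_lint), and it elaborates with this file. -/

/-- DECIDING THEOREM (D-0027 §2.1): the target `VanishingStrassenDefect` (X) and the provable-now
support `DefectInequality` (one line of Strassen calculus: `(mN)^ω ≤ m²·N^ω + R~(J)`) decide
`ω(ℂ) = 2`. `ω ≥ 2` is the proved flattening bound `omega_two_le`; for `ω ≤ 2 + δ` take the
instance `(m, N, J)` of X at `ε := δ·log 2 > 0`: `m^ω·N^ω = (mN)^ω ≤ m²N^ω + ε·m²N² ≤ (1+ε)·m²·N^ω`
(`N² ≤ N^ω` as `ω ≥ 2`, `N ≥ 1`), so `m^ω ≤ (1+ε)·m²`; taking logs,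
`ω·log m ≤ log(1+ε) + 2·log m ≤ ε + 2·log m = δ·log 2 + 2·log m ≤ (2+δ)·log m` (`m ≥ 2`), and
`log m > 0` gives `ω ≤ 2 + δ`. Real-analysis bookkeeping only; no item other than X and
DefectInequality is load-bearing for the decision. -/
@[closes "route-MatrixMultiplication-StrassenDefect"] theorem closes (hX : VanishingStrassenDefect) (hD : DefectInequality) : MatrixMultiplication := by
  show Literature.Computability.AlgebraicComplexity.omega ℂ = 2
  have h2 : (2 : ℝ) ≤ Literature.Computability.AlgebraicComplexity.omega ℂ :=
    Literature.Computability.AlgebraicComplexity.omega_two_le ℂ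
  refine le_antisymm ?_ h2
  refine le_of_forall_pos_le_add fun δ hδ => ?_
  have hlog2 : (0 : ℝ) < Real.log 2 := Real.log_pos one_lt_two
  have hε : (0 : ℝ) < δ * Real.log 2 := mul_pos hδ hlog2
  obtain ⟨m, N, a, b, c, hm, hN, J, hdeg, hJ⟩ := hX (δ * Real.log 2) hε
  have hineq := hD m N a b c (le_trans one_le_two hm) hN J hdeg
  have hm2 : (2 : ℝ) ≤ m := by exact_mod_cast hm
  have hm0 : (0 : ℝ) < m := by linarith
  have hN1 : (1 : ℝ) ≤ N := by exact_mod_cast hN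
  have hN0 : (0 : ℝ) < N := by linarith
  have hNω : (0 : ℝ) < (N : ℝ) ^ Literature.Computability.AlgebraicComplexity.omega ℂ :=
    Real.rpow_pos_of_pos hN0 _
  have hNsq : (N : ℝ) ^ 2 ≤ (N : ℝ) ^ Literature.Computability.AlgebraicComplexity.omega ℂ := by
    calc (N : ℝ) ^ 2 = (N : ℝ) ^ ((2 : ℕ) : ℝ) := (Real.rpow_natCast _ 2).symm
      _ ≤ (N : ℝ) ^ Literature.Computability.AlgebraicComplexity.omega ℂ :=
          Real.rpow_le_rpow_of_exponent_le hN1 (by push_cast; exact h2)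
  have key : (m : ℝ) ^ Literature.Computability.AlgebraicComplexity.omega ℂ *
        (N : ℝ) ^ Literature.Computability.AlgebraicComplexity.omega ℂ ≤
      ((1 + δ * Real.log 2) * (m : ℝ) ^ 2) *
        (N : ℝ) ^ Literature.Computability.AlgebraicComplexity.omega ℂ := by
    have hmono : δ * Real.log 2 * ((m : ℝ) ^ 2 * (N : ℝ) ^ 2) ≤
        δ * Real.log 2 * ((m : ℝ) ^ 2 *
          (N : ℝ) ^ Literature.Computability.AlgebraicComplexity.omega ℂ) :=
      mul_le_mul_of_nonneg_left (mul_le_mul_of_nonneg_left hNsq (sq_nonneg _)) hε.le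
    calc (m : ℝ) ^ Literature.Computability.AlgebraicComplexity.omega ℂ *
          (N : ℝ) ^ Literature.Computability.AlgebraicComplexity.omega ℂ
          = ((m : ℝ) * N) ^ Literature.Computability.AlgebraicComplexity.omega ℂ :=
            (Real.mul_rpow hm0.le hN0.le).symm
      _ ≤ (m : ℝ) ^ 2 * (N : ℝ) ^ Literature.Computability.AlgebraicComplexity.omega ℂ +
            Literature.Computability.AlgebraicComplexity.asymptoticRank J := hineq
      _ ≤ (m : ℝ) ^ 2 * (N : ℝ) ^ Literature.Computability.AlgebraicComplexity.omega ℂ +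
            δ * Real.log 2 * ((m : ℝ) ^ 2 *
              (N : ℝ) ^ Literature.Computability.AlgebraicComplexity.omega ℂ) := by
            linarith
      _ = ((1 + δ * Real.log 2) * (m : ℝ) ^ 2) *
            (N : ℝ) ^ Literature.Computability.AlgebraicComplexity.omega ℂ := by ring
  have key2 : (m : ℝ) ^ Literature.Computability.AlgebraicComplexity.omega ℂ ≤
      (1 + δ * Real.log 2) * (m : ℝ) ^ 2 := le_of_mul_le_mul_right key hNω
  have hlogm : Real.log 2 ≤ Real.log m := Real.log_le_log two_pos hm2
  have hlogm0 : (0 : ℝ) < Real.log m := lt_of_lt_of_le hlog2 hlogm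
  have hlog1 : Real.log (1 + δ * Real.log 2) ≤ δ * Real.log 2 := by
    rw [Real.log_le_iff_le_exp (by positivity)]
    linarith [Real.add_one_le_exp (δ * Real.log 2)]
  have hlogkey := Real.log_le_log (Real.rpow_pos_of_pos hm0 _) key2
  rw [Real.log_rpow hm0, Real.log_mul (by positivity) (by positivity), Real.log_pow] at hlogkey
  push_cast at hlogkey
  have hδm : δ * Real.log 2 ≤ δ * Real.log m := mul_le_mul_of_nonneg_left hlogm hδ.le
  by_contra hcon
  have hlt : 2 + δ < Literature.Computability.AlgebraicComplexity.omega ℂ := lt_of_not_ge hcon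
  have hpos : (0 : ℝ) <
      (Literature.Computability.AlgebraicComplexity.omega ℂ - 2 - δ) * Real.log m :=
    mul_pos (by linarith) hlogm0
  nlinarith

end Summit.MatrixMultiplication.MatrixMultiplication.Theses.StrassenDefect
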